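import Literature.Barriers.CriticalPhenomena.KozmaNachmiasLemma31
import HarnessLib

/-!
# The lower half of `ρ_ex = 1/2` ((11.3.2)) is dimension-free: `P_{p_c}(0 ↔ ∂Λ_n) ≥ c n^{1-d}`
# on every `ℤ^d`, hence `≥ c/n²` on `ℤ²` and `ℤ³`

Barrier catalogue `Literature/Barriers/CriticalPhenomena/` (D-0021), companion of
`LaceExpansionHighDimension.lean` / `LaceExpansionHighDimensionProofs.lean` (conjunct
`PercolationContinuityZ3`), written during the barrier audit of the latter (2026-08-15, gen 2).
The catalogue statement `RhoExHalf d` is (11.3.2) of Heydenreich–van der Hofstad 2017 as printed,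
a TWO-sided bound `c_ex/n² ≤ P_{p_c}(0 ↔ ∂Λ_n) ≤ C_ex/n²`. The audits of Cor. 11.7 recorded that
only its upper half carries the dimensional obstruction (`six_le_of_axis_lower_of_oneArm_upper`,
`MeanFieldOneArmHighDimension`). This file records the complementary fact about the lower half:
it needs no lace-expansion or two-point input at all in low dimension. By Kozma–Nachmias 2011,
Lemma 3.1 (all dimensions, `p ≥ p_c`: `Σ_{z ∈ ∂Q_r} P(0 ↔ z in Q_r) ≥ 1`; in the tree, for the
nearest-neighbour lattice and with constant `1/(2d)`, `sum_sphere_real_openConnIn_ge` of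
`KozmaNachmiasLemma31.lean`, proved through Duminil-Copin–Tassion's `φ_{p_c}(S) ≥ 1`), some
`z ∈ ∂Λ_n` has `P_{p_c}(0 ↔ z in Λ_n) ≥ 1/(2d |∂Λ_n|)`, and such a restricted connection realises
the one-arm event. Hence (all PROVED, sorry-free):

* `real_openConnIn_box_le_oneArmProb` — `P_p(0 ↔ z in Λ_n) ≤ P_p(0 ↔ ∂Λ_n)` for `z ∈ ∂Λ_n`;
* `one_le_mul_oneArmProb_criticalProbI` — `1 ≤ 2d · |∂Λ_n| · P_{p_c}(0 ↔ ∂Λ_n)` (`d ≥ 2`, `n ≥ 1`);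
* `exists_oneArmProb_criticalProbI_lower` — `P_{p_c}(0 ↔ ∂Λ_n) ≥ c/n^{d-1}` for all `n ≥ 1`
  (`|∂Λ_n| ≤ 2d·3^{d-1} n^{d-1}`), the input-free lower bound quoted e.g. by
  van Engelenburg–Garban–Panis–Severo 2025, §1.2 (footnote: "`φ_{p_c}(Λ_n) ≥ 1` … one has
  `P_{p_c}[0 ↔ Λ_n^c] ≳ n^{1-d}`");
* `exists_oneArmProb_criticalProbI_lower_sq` — for `2 ≤ d ≤ 3`, `P_{p_c}(0 ↔ ∂Λ_n) ≥ c/n²`;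
* `rhoExHalf_iff_oneArm_upper_of_le_three` — on `ℤ²` and `ℤ³`, `RhoExHalf d` is EQUIVALENT to
  its upper half `P_{p_c}(0 ↔ ∂Λ_n) ≤ C/n²`;
* `TwoPointBoundedRatio.not_oneArm_upper_three` — so on `ℤ³` Aizenman's two-sided (t-c) with
  `η = 0` already excludes the one-arm upper bound alone (cf. `TwoPointBoundedRatio.six_le`).

(For `d = 4` the lower half also follows from the pointwise form of `δ ≥ 2`,
`P_{p_c}(|C(0)| ≥ s) ≥ c/√s` with `s = |Λ_n| + 1`; not formalised here, the tree keeping only the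
generating-function form of Aizenman–Barsky's bound, cf. `LaceExpansionHighDimensionOneArm.lean`.)

## References

* G. Kozma, A. Nachmias, *Arm exponents in high dimensional percolation*, J. Amer. Math. Soc. 24
  (2011) 375–409 (arXiv:0911.0871): Lemma 3.1 (p. 384) and the proof of Lemma 1.1 (§3: "there
  exist some `y` such that `P(0 ↔ y in Q_{M_i}) ≥ c M_i^{1-d}`").
* M. Heydenreich, R. van der Hofstad, *Progress in High-Dimensional Percolation and Random
  Graphs*, Springer 2017: Thm. 11.5 (11.3.2) (p. 139), Cor. 11.7 (pp. 144–145).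
* D. van Engelenburg, C. Garban, R. Panis, F. Severo, *One-arm exponents of high-dimensional
  percolation revisited*, arXiv:2510.21595 (2025): §1.2, footnote 1.
* H. Duminil-Copin, V. Tassion, Enseign. Math. 62 (2016) 199–206: `φ_p(S)`, Thm. 1.1.
* M. Aizenman, Nuclear Phys. B 485 (1997) 551–582, §5 (condition (t-c)).
-/

noncomputable section

namespace Literature.Barriers.CriticalPhenomena

open _root_.MeasureTheory Finset Literature.Probability.LatticeModels Literature.Probability.Percolation
  Literature.Probability.Percolation.DCT16

variable {d : ℕ}

/-- A restricted connection `0 ↔ z in Λ_n` to a point `z` of the inner vertex boundary of `Λ_n`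
realises the one-arm event `{0 ↔ ∂Λ_n}` (`siteToBoundary`), so `P_p(0 ↔ z in Λ_n) ≤ P_p(0 ↔ ∂Λ_n)`.
[folklore] -/
theorem real_openConnIn_box_le_oneArmProb (p : unitInterval) {n : ℕ} {z : Site d}
    (hz : z ∈ innerBoundary (zdGraph d) (box d n)) :
    (bondPercolation (zdGraph d) p).real (openConnIn (↑(box d n) : Set (Site d)) 0 z) ≤
      oneArmProb d p n :=
  measureReal_mono fun _ hω => ⟨z, hz, hω⟩

/-- **Kozma–Nachmias 2011, Lemma 3.1 ⟹ `1 ≤ 2d · |∂Λ_n| · P_{p_c}(0 ↔ ∂Λ_n)`** on `ℤ^d`, `d ≥ 2`,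
`n ≥ 1`: by `sum_sphere_real_openConnIn_ge` (`Σ_{z ∈ ∂Λ_n} P_{p_c}(0 ↔ z in Λ_n) ≥ 1/(2d)`) and
`real_openConnIn_box_le_oneArmProb` (each summand is at most `P_{p_c}(0 ↔ ∂Λ_n)`,
`∂Λ_n = innerBoundary Λ_n` for `n ≥ 1`). [cite: KozmaNachmias2011, Lemma 3.1 and proof of Lemma 1.1 (§3)] -/
theorem one_le_mul_oneArmProb_criticalProbI (hd : 2 ≤ d) {n : ℕ} (hn : 1 ≤ n) :
    1 ≤ 2 * d * #(sphere d n) * oneArmProb d (criticalProbI d) n := by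
  have hd0 : (0 : ℝ) < d := by exact_mod_cast (show 0 < d by omega)
  have hsum := sum_sphere_real_openConnIn_ge hd (criticalProbI d) le_rfl n
  have hle : ∑ z ∈ sphere d n, (bondPercolation (zdGraph d) (criticalProbI d)).real
      (openConnIn (↑(box d n) : Set (Site d)) 0 z) ≤ #(sphere d n) * oneArmProb d (criticalProbI d) n := by
    rw [← nsmul_eq_mul, ← Finset.sum_const]
    refine Finset.sum_le_sum fun z hz => real_openConnIn_box_le_oneArmProb _ ?_
    rwa [innerBoundary_box hn]
  have h : 1 / (2 * (d : ℝ)) ≤ #(sphere d n) * oneArmProb d (criticalProbI d) n := hsum.trans hle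
  rw [div_le_iff₀' (by positivity)] at h
  linarith

/-- **The input-free lower bound `P_{p_c}(0 ↔ ∂Λ_n) ≥ c/n^{d-1}`** on `ℤ^d`, `d ≥ 2`, for all
`n ≥ 1`, with `c = c(d) > 0` (`|∂Λ_n| ≤ 2d·3^{d-1} n^{d-1}`, `card_sphere_succ_le'`). This is the
general-dimension bound behind Kozma–Nachmias's Lemma 1.1 and the footnote of
van Engelenburg–Garban–Panis–Severo 2025, §1.2; the sharp order is `n^{-2}` for `d > 6`
(Kozma–Nachmias, Thm. 1) and `n^{-5/48}` on the planar triangular lattice.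
[cite: KozmaNachmias2011, Lemma 3.1 and Lemma 1.1] [cite: VanEngelenburgGarbanPanisSevero2025, §1.2 (footnote 1)] -/
theorem exists_oneArmProb_criticalProbI_lower (hd : 2 ≤ d) :
    ∃ c : ℝ, 0 < c ∧ ∀ n : ℕ, 1 ≤ n → c / (n : ℝ) ^ (d - 1) ≤ oneArmProb d (criticalProbI d) n := by
  refine ⟨1 / (2 * d * (2 * d * 3 ^ (d - 1))), by positivity, fun n hn => ?_⟩
  obtain ⟨k, rfl⟩ : ∃ k, n = k + 1 := ⟨n - 1, by omega⟩
  have h := one_le_mul_oneArmProb_criticalProbI hd (n := k + 1) (by omega)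
  have hcard := card_sphere_succ_le' (d := d) (by omega) k
  have harm : 0 ≤ oneArmProb d (criticalProbI d) (k + 1) := measureReal_nonneg
  set A : ℝ := 2 * d * (2 * d * 3 ^ (d - 1) * ((k : ℝ) + 1) ^ (d - 1)) with hA
  have hApos : 0 < A := by positivity
  have hle : 2 * d * (#(sphere d (k + 1)) : ℝ) ≤ A := by
    rw [hA]; exact mul_le_mul_of_nonneg_left hcard (by positivity)
  have h' : 1 ≤ A * oneArmProb d (criticalProbI d) (k + 1) :=
    h.trans (mul_le_mul_of_nonneg_right hle harm)
  have hgoal : 1 / A ≤ oneArmProb d (criticalProbI d) (k + 1) := by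
    rw [div_le_iff₀' hApos]; exact h'
  calc 1 / (2 * d * (2 * d * 3 ^ (d - 1))) / (((k + 1 : ℕ) : ℝ)) ^ (d - 1) = 1 / A := by
        rw [hA]; push_cast; rw [div_div]; ring
    _ ≤ _ := hgoal

/-- In dimensions `2 ≤ d ≤ 3` the input-free bound is already of mean-field order:
`c/n² ≤ P_{p_c}(0 ↔ ∂Λ_n)` for all `n ≥ 1`, i.e. the LOWER half of (11.3.2) (`RhoExHalf d`) holds
on `ℤ²` and `ℤ³` without any two-point or lace-expansion input.
[cite: KozmaNachmias2011, Lemma 3.1] [cite: HeydenreichVanDerHofstad2017, Thm. 11.5 (11.3.2), lower bound] -/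
theorem exists_oneArmProb_criticalProbI_lower_sq (hd2 : 2 ≤ d) (hd3 : d ≤ 3) :
    ∃ c : ℝ, 0 < c ∧ ∀ n : ℕ, 1 ≤ n → c / (n : ℝ) ^ 2 ≤ oneArmProb d (criticalProbI d) n := by
  obtain ⟨c, hc, h⟩ := exists_oneArmProb_criticalProbI_lower hd2
  refine ⟨c, hc, fun n hn => le_trans ?_ (h n hn)⟩
  have hn1 : (1 : ℝ) ≤ n := by exact_mod_cast hn
  exact div_le_div_of_nonneg_left hc.le (by positivity) (pow_le_pow_right₀ hn1 (by omega))

/-- Hence on `ℤ²` and `ℤ³` the catalogue statement `RhoExHalf d` ((11.3.2), two-sided) is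
EQUIVALENT to its upper half `P_{p_c}(0 ↔ ∂Λ_n) ≤ C/n²` alone — the half that carries the
dimensional obstruction (Cor. 11.7; `MeanFieldOneArmHighDimension` of
`LaceExpansionHighDimensionOneArm.lean`). [cite: HeydenreichVanDerHofstad2017, Thm. 11.5 (11.3.2) and Cor. 11.7] -/
theorem rhoExHalf_iff_oneArm_upper_of_le_three (hd2 : 2 ≤ d) (hd3 : d ≤ 3) :
    RhoExHalf d ↔
      ∃ C : ℝ, ∀ n : ℕ, 1 ≤ n → oneArmProb d (criticalProbI d) n ≤ C / (n : ℝ) ^ 2 := by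
  constructor
  · rintro ⟨_, C, -, h⟩
    exact ⟨C, fun n hn => (h n hn).2⟩
  · rintro ⟨C, hC⟩
    obtain ⟨c, hc, h⟩ := exists_oneArmProb_criticalProbI_lower_sq hd2 hd3
    exact ⟨c, C, hc, fun n hn => ⟨h n hn, hC n hn⟩⟩

/-- In particular, on `ℤ³`, Aizenman's two-sided condition (t-c) with `η = 0`
(`TwoPointBoundedRatio 3`) is incompatible with the one-arm UPPER bound `P_{p_c}(0 ↔ ∂Λ_n) ≤ C/n²`
alone, the lower half of (11.3.2) being automatic (compare `TwoPointBoundedRatio.not_rhoExHalf_three`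
and `TwoPointBoundedRatio.six_le`). [cite: HeydenreichVanDerHofstad2017, Cor. 11.7] [cite: Aizenman1997, §5 ((t-c))] -/
theorem TwoPointBoundedRatio.not_oneArm_upper_three (hτ : TwoPointBoundedRatio 3) :
    ¬ ∃ C : ℝ, ∀ n : ℕ, 1 ≤ n → oneArmProb 3 (criticalProbI 3) n ≤ C / (n : ℝ) ^ 2 := fun h =>
  hτ.not_rhoExHalf_three ((rhoExHalf_iff_oneArm_upper_of_le_three (d := 3) (by norm_num) le_rfl).2 h)

end Literature.Barriers.CriticalPhenomena

end
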